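import Literature.NumberTheory.LFunctions.MoebiusAutomaticCarry
import Literature.NumberTheory.LFunctions.MauduitRivatWindowCount
import HarnessLib

/-!
# Truncations `f_λ`, the middle-digit quotient `f_{μ₁,μ₂}` and Mauduit–Rivat's Lemma 9 (Müllner 2017 Lemma 5.3; proved)

Everything in this file is PROVED. For a group-valued `f : ℕ → G` with the carry property
(C. Müllner, Duke Math. J. 166 (2017), Def. 4.1; tree `HasCarryProperty`, prefix-cancelling
quotient `f x · (f y)⁻¹`) we set up the truncations of C. Mauduit, J. Rivat, J. Eur. Math. Soc.
17 (2015), (5) and (56), in the tree's (mirrored) multiplication order: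

* `trunc k λ f = f_λ : n ↦ f(n mod k^λ)`;
* `midQuot k μ₁ μ₂ f = f_{μ₁}⁻¹ · f_{μ₂}` — the analogue of `f_{μ₁,μ₂} = f_{μ₂} \overline{f_{μ₁}}`
  ((56)); the inverse sits on the LEFT because in the tree's transducer convention the
  low digits are the leftmost factor, so that `f_{μ₂} = f_{μ₁} · midQuot`;
* `midDigit k μ₀ μ₂ x = r_{μ₀,μ₂}(x) = ⌊(x mod k^{μ₂})/k^{μ₀}⌋` (MR §3), and
  `midFun k μ₀ μ₁ μ₂ f = g : u ↦ midQuot (k^{μ₀} u)` ((62));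
* `midQuot_eq_midFun_of_not_mem` — **Lemma 9 / Lemma 5.3, pointwise**: if `r_{μ₀,μ₂}(x)` is not
  a carry violation of scale `(μ₂−μ₀, μ₀, μ₁−μ₀)` then `midQuot x = g(r_{μ₀,μ₂}(x))` (the digits
  below `μ₀` do not matter);
* `card_box_midDigit_mem_le` — **Lemma 9 / Lemma 5.3, counting** (directly, by
  `MauduitRivatWindowCount.card_window_le`, instead of the printed smoothed-indicator argument):
  the pairs `(m, n) ∈ [M₀, M₁) × [N₀, N₀+N)` with `r_{μ₀,μ₂}(mn + c) ∈ B` number at most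
  `#B · ((M₁−M₀)(N k^{μ₀}/k^{μ₂} + k^{μ₀} + 2) + 4 τ(k^{μ₂}) M₁ N / k^{μ₂})`, and
  `#B ≤ C k^{(μ₂−μ₀) − η(μ₁−μ₀)}` for the carry violations (`card_midViolations_le`);
* `quot_word_conj` — the group identity behind Müllner's "tr(S̃₂') = tr(S₂')" (p. 28): with
  `w(x, y) = f_{μ₂}(x) f_{μ₂}(y)⁻¹`, if `f_{μ₁}(x₁) = f_{μ₁}(x₄)` and `f_{μ₁}(x₂) = f_{μ₁}(x₃)` then
  `w(x₁,x₂) w(x₄,x₃)⁻¹ = P (φx₁ (φx₂)⁻¹ φx₃ (φx₄)⁻¹) P⁻¹`, `P = f_{μ₁}(x₁)`, `φ = midQuot`,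
  together with `trunc_add_mul_pow_mul` (`f_{μ₁}((m + s k^{μ₁}) n) = f_{μ₁}(mn)`).

## References
* C. Mauduit, J. Rivat, J. Eur. Math. Soc. 17 (2015): §3 (`r_{κ₁,κ₂}`), (56), (62), Lemma 9
  (pp. 2603–2605). [MauduitRivat2015]
* C. Müllner, Duke Math. J. 166 (2017) = arXiv:1602.03042: Def. 4.1, Lemma 5.3, §5.4.2
  (pp. 19, 26–28). [Mullner2017]
-/

noncomputable section

open Finset

namespace Literature.NumberTheory.LFunctions.MauduitRivat

section Plain

variable {G : Type*}

/-! ## Truncations -/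

/-- `f_λ(n) = f(n mod k^λ)` (MR (5)). [cite: MauduitRivat2015, (5)] -/
def trunc (k lam : ℕ) (f : ℕ → G) : ℕ → G := fun n => f (n % k ^ lam)

/-- Unfolding. [folklore] -/
theorem trunc_apply (k lam : ℕ) (f : ℕ → G) (n : ℕ) : trunc k lam f n = f (n % k ^ lam) := rfl

/-- `f_λ(n) = f(n)` for `n < k^λ`. [folklore] -/
theorem trunc_of_lt {k lam : ℕ} (f : ℕ → G) {n : ℕ} (hn : n < k ^ lam) : trunc k lam f n = f n := by
  rw [trunc_apply, Nat.mod_eq_of_lt hn]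

/-- `f_λ` is `k^λ`-periodic: `f_λ(n + t k^λ) = f_λ(n)`. [folklore] -/
theorem trunc_add_mul_pow (k lam : ℕ) (f : ℕ → G) (n t : ℕ) :
    trunc k lam f (n + t * k ^ lam) = trunc k lam f n := by
  simp [trunc_apply]

/-- `f_{μ₁}((m + s k^{μ₁}) n) = f_{μ₁}(mn)` (MR: "observing that
`f_{μ₁}((m + sq^{μ₁})(n+r)) = f_{μ₁}(m(n+r))`"). [cite: MauduitRivat2015, before (56)] -/
theorem trunc_add_mul_pow_mul (k μ₁ : ℕ) (f : ℕ → G) (m s n : ℕ) :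
    trunc k μ₁ f ((m + s * k ^ μ₁) * n) = trunc k μ₁ f (m * n) := by
  rw [add_mul, mul_assoc, mul_comm (k ^ μ₁) n, ← mul_assoc, trunc_add_mul_pow]

end Plain

section Group

variable {G : Type*} [Group G]

/-- The middle-digit quotient `φ = f_{μ₁}⁻¹ · f_{μ₂}` (the tree-order analogue of MR's
`f_{μ₁,μ₂} = f_{μ₂}\overline{f_{μ₁}}`, (56)), so that `f_{μ₂} = f_{μ₁} · φ`.
[cite: MauduitRivat2015, (56)] -/
def midQuot (k μ₁ μ₂ : ℕ) (f : ℕ → G) : ℕ → G := fun n => (trunc k μ₁ f n)⁻¹ * trunc k μ₂ f n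

/-- Unfolding. [folklore] -/
theorem midQuot_apply (k μ₁ μ₂ : ℕ) (f : ℕ → G) (n : ℕ) :
    midQuot k μ₁ μ₂ f n = (trunc k μ₁ f n)⁻¹ * trunc k μ₂ f n := rfl

/-- `f_{μ₂} = f_{μ₁} · φ`. [cite: MauduitRivat2015, (56)] -/
theorem trunc_mul_midQuot (k μ₁ μ₂ : ℕ) (f : ℕ → G) (n : ℕ) :
    trunc k μ₁ f n * midQuot k μ₁ μ₂ f n = trunc k μ₂ f n := by
  rw [midQuot_apply, mul_inv_cancel_left]

/-- The middle digits `r_{μ₀,μ₂}(x) = ⌊(x mod k^{μ₂}) / k^{μ₀}⌋` (digits of indices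
`μ₀, …, μ₂ − 1`). [cite: MauduitRivat2015, §3] -/
def midDigit (k μ₀ μ₂ : ℕ) (x : ℕ) : ℕ := x % k ^ μ₂ / k ^ μ₀

/-- Unfolding. [folklore] -/
theorem midDigit_apply (k μ₀ μ₂ x : ℕ) : midDigit k μ₀ μ₂ x = x % k ^ μ₂ / k ^ μ₀ := rfl

/-- `r_{μ₀,μ₂}(x) < k^{μ₂−μ₀}` (`k ≥ 1`, `μ₀ ≤ μ₂`). [folklore] -/
theorem midDigit_lt {k : ℕ} (hk : 0 < k) {μ₀ μ₂ : ℕ} (hμ : μ₀ ≤ μ₂) (x : ℕ) :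
    midDigit k μ₀ μ₂ x < k ^ (μ₂ - μ₀) := by
  rw [midDigit_apply, Nat.div_lt_iff_lt_mul (by positivity), ← pow_add, Nat.sub_add_cancel hμ]
  exact Nat.mod_lt _ (by positivity)

/-- `x mod k^{μ₂} = r_{μ₀,μ₂}(x) k^{μ₀} + (x mod k^{μ₀})` (`μ₀ ≤ μ₂`). [folklore] -/
theorem mod_pow_eq_midDigit {k μ₀ μ₂ : ℕ} (hμ : μ₀ ≤ μ₂) (x : ℕ) :
    x % k ^ μ₂ = midDigit k μ₀ μ₂ x * k ^ μ₀ + x % k ^ μ₀ := by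
  rw [midDigit_apply]
  have h1 : x % k ^ μ₂ % k ^ μ₀ = x % k ^ μ₀ :=
    Nat.mod_mod_of_dvd _ (pow_dvd_pow k hμ)
  have h2 := Nat.div_add_mod (x % k ^ μ₂) (k ^ μ₀)
  rw [h1] at h2
  rw [mul_comm]
  exact h2.symm

/-- `x mod k^{μ₁} = (x mod k^{μ₂}) mod k^{μ₁}` for `μ₁ ≤ μ₂`. [folklore] -/
theorem mod_pow_mod_pow {k μ₁ μ₂ : ℕ} (hμ : μ₁ ≤ μ₂) (x : ℕ) : x % k ^ μ₂ % k ^ μ₁ = x % k ^ μ₁ :=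
  Nat.mod_mod_of_dvd _ (pow_dvd_pow k hμ)

/-- The function `g(u) = φ(k^{μ₀} u)` of the middle digits (MR (62)). [cite: MauduitRivat2015, (62)] -/
def midFun (k μ₀ μ₁ μ₂ : ℕ) (f : ℕ → G) : ℕ → G := fun u => midQuot k μ₁ μ₂ f (u * k ^ μ₀)

/-- Unfolding. [folklore] -/
theorem midFun_apply (k μ₀ μ₁ μ₂ : ℕ) (f : ℕ → G) (u : ℕ) :
    midFun k μ₀ μ₁ μ₂ f u = midQuot k μ₁ μ₂ f (u * k ^ μ₀) := rfl

/-! ## Lemma 9, pointwise: `φ` depends only on the digits `μ₀ … μ₂−1` off the carry violations -/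

/-- The carry violations relevant to Lemma 9: scale `(λ, α, ρ) = (μ₂ − μ₀, μ₀, μ₁ − μ₀)`.
[cite: MauduitRivat2015, Lemma 9 (proof, the set B)] -/
def midViolations (k μ₀ μ₁ μ₂ : ℕ) (f : ℕ → G) : Finset ℕ :=
  carryViolations k f (μ₂ - μ₀) μ₀ (μ₁ - μ₀)

/-- **Mauduit–Rivat Lemma 9 / Müllner Lemma 5.3, pointwise.** Let `μ₀ ≤ μ₁ ≤ μ₂`, `k ≥ 1`. If
`ℓ = r_{μ₀,μ₂}(x)` is not a carry violation of scale `(μ₂−μ₀, μ₀, μ₁−μ₀)` then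
`φ(x) = g(ℓ)`, i.e. `f_{μ₁}(x)⁻¹ f_{μ₂}(x) = f_{μ₁}(k^{μ₀}ℓ)⁻¹ f_{μ₂}(k^{μ₀}ℓ)`.
[cite: MauduitRivat2015, Lemma 9; Mullner2017, Lemma 5.3] -/
theorem midQuot_eq_midFun_of_not_mem {k : ℕ} (hk : 0 < k) {μ₀ μ₁ μ₂ : ℕ} (h01 : μ₀ ≤ μ₁)
    (h12 : μ₁ ≤ μ₂) (f : ℕ → G) {x : ℕ}
    (hx : midDigit k μ₀ μ₂ x ∉ midViolations k μ₀ μ₁ μ₂ f) :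
    midQuot k μ₁ μ₂ f x = midFun k μ₀ μ₁ μ₂ f (midDigit k μ₀ μ₂ x) := by
  have h02 : μ₀ ≤ μ₂ := h01.trans h12
  set ℓ := midDigit k μ₀ μ₂ x with hℓ
  set n₂ := x % k ^ μ₀ with hn₂
  have hn₂lt : n₂ < k ^ μ₀ := Nat.mod_lt _ (by positivity)
  have hℓlt : ℓ < k ^ (μ₂ - μ₀) := midDigit_lt hk h02 x
  -- the non-violation with `n₁ = 0`
  have hnv : f (ℓ * k ^ μ₀ + 0 + n₂) * (f (ℓ * k ^ μ₀ + 0))⁻¹ =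
      f ((ℓ * k ^ μ₀ + 0 + n₂) % k ^ (μ₀ + (μ₁ - μ₀))) *
        (f ((ℓ * k ^ μ₀ + 0) % k ^ (μ₀ + (μ₁ - μ₀))))⁻¹ := by
    by_contra hne
    exact hx (mem_carryViolations.2 ⟨hℓlt, 0, by positivity, n₂, hn₂lt, hne⟩)
  simp only [add_zero, Nat.add_sub_cancel' h01] at hnv
  -- identify the four values
  have hx2 : x % k ^ μ₂ = ℓ * k ^ μ₀ + n₂ := mod_pow_eq_midDigit h02 x
  have hℓμ₂ : ℓ * k ^ μ₀ < k ^ μ₂ := by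
    calc ℓ * k ^ μ₀ < k ^ (μ₂ - μ₀) * k ^ μ₀ := Nat.mul_lt_mul_of_pos_right hℓlt (by positivity)
      _ = k ^ μ₂ := by rw [← pow_add, Nat.sub_add_cancel h02]
  have e1 : trunc k μ₂ f x = f (ℓ * k ^ μ₀ + n₂) := by rw [trunc_apply, hx2]
  have e2 : trunc k μ₂ f (ℓ * k ^ μ₀) = f (ℓ * k ^ μ₀) := trunc_of_lt f hℓμ₂
  have e3 : trunc k μ₁ f x = f ((ℓ * k ^ μ₀ + n₂) % k ^ μ₁) := by
    rw [trunc_apply, ← mod_pow_mod_pow h12 x, hx2]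
  have e4 : trunc k μ₁ f (ℓ * k ^ μ₀) = f ((ℓ * k ^ μ₀) % k ^ μ₁) := rfl
  rw [midFun_apply, midQuot_apply, midQuot_apply, e1, e2, e3, e4]
  -- from `a b⁻¹ = c d⁻¹` deduce `c⁻¹ a = d⁻¹ b`
  have key : ∀ a b c d : G, a * b⁻¹ = c * d⁻¹ → c⁻¹ * a = d⁻¹ * b := by
    intro a b c d h
    have h' : a = c * d⁻¹ * b := by rw [← h, inv_mul_cancel_right]
    rw [h']
    group
  exact key _ _ _ _ hnv

/-! ## Lemma 9, counting -/

/-- The carry violations of Lemma 9 are few: `#B ≤ C k^{(μ₂−μ₀) − η(μ₁−μ₀)}` (`μ₁ < μ₂`).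
[cite: MauduitRivat2015, Lemma 9 (proof, "card B = O(q^{μ₂−μ₁})"); Mullner2017, Lemma 5.3] -/
theorem card_midViolations_le {k : ℕ} {η C : ℝ} {f : ℕ → G} (hf : HasCarryProperty k η C f)
    {μ₀ μ₁ μ₂ : ℕ} (h01 : μ₀ ≤ μ₁) (h12 : μ₁ < μ₂) :
    ((midViolations k μ₀ μ₁ μ₂ f).card : ℝ) ≤
      C * (k : ℝ) ^ (((μ₂ - μ₀ : ℕ) : ℝ) - η * ((μ₁ - μ₀ : ℕ) : ℝ)) := by
  have h := hf (μ₂ - μ₀) μ₀ (μ₁ - μ₀) (by omega)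
  exact h

/-- `r_{μ₀,μ₂}(x) = ℓ` forces `x mod k^{μ₂}` into the window `[ℓ k^{μ₀}, ℓ k^{μ₀} + k^{μ₀})`.
[cite: MauduitRivat2015, (11)] -/
theorem window_of_midDigit_eq {k μ₀ μ₂ : ℕ} (hk : 0 < k) (hμ : μ₀ ≤ μ₂) (x : ℕ) :
    midDigit k μ₀ μ₂ x * k ^ μ₀ ≤ x % k ^ μ₂ ∧
      x % k ^ μ₂ < midDigit k μ₀ μ₂ x * k ^ μ₀ + k ^ μ₀ := by
  have h := mod_pow_eq_midDigit (k := k) hμ x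
  have hlt : x % k ^ μ₀ < k ^ μ₀ := Nat.mod_lt _ (by positivity)
  generalize x % k ^ μ₀ = r at h hlt
  generalize x % k ^ μ₂ = y at h ⊢
  generalize midDigit k μ₀ μ₂ x * k ^ μ₀ = z at h ⊢
  constructor <;> omega

/-- **Mauduit–Rivat Lemma 9 / Müllner Lemma 5.3, counting form** (proved by direct counting): for
`k ≥ 1`, `μ₀ ≤ μ₂`, a set `B` of middle-digit values, `c ∈ ℕ` and a box
`[M₀, M₁) × [N₀, N₀ + N)` with `M₀ ≥ 1`,
`#{(m,n) : r_{μ₀,μ₂}(mn + c) ∈ B} ≤ #B · ∑_{m} (N gcd(m,k^{μ₂})/k^{μ₂} + 1)(k^{μ₀}/gcd(m,k^{μ₂}) + 2)`.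
[cite: MauduitRivat2015, Lemma 9; Mullner2017, Lemma 5.3] -/
theorem card_box_midDigit_mem_le_sum {k : ℕ} (hk : 0 < k) {μ₀ μ₂ : ℕ} (hμ : μ₀ ≤ μ₂)
    (B : Finset ℕ) (c M₀ M₁ N₀ N : ℕ) :
    (((Ico M₀ M₁) ×ˢ (Ico N₀ (N₀ + N))).filter
        (fun p : ℕ × ℕ => midDigit k μ₀ μ₂ (p.1 * p.2 + c) ∈ B)).card ≤
      B.card * ∑ m ∈ Ico M₀ M₁,
        (N * Nat.gcd m (k ^ μ₂) / k ^ μ₂ + 1) * (k ^ μ₀ / Nat.gcd m (k ^ μ₂) + 2) := by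
  have hQ : 0 < k ^ μ₂ := by positivity
  rw [card_filter, sum_product, mul_sum]
  refine sum_le_sum fun m _ => ?_
  rw [← card_filter]
  -- reduce to the window count with `starts = B.image (· * k^{μ₀})`
  calc ((Ico N₀ (N₀ + N)).filter (fun n => midDigit k μ₀ μ₂ (m * n + c) ∈ B)).card
      ≤ ((Ico N₀ (N₀ + N)).filter (fun n => ∃ a ∈ B.image (fun ℓ => ℓ * k ^ μ₀),
          a ≤ (m * n + c) % k ^ μ₂ ∧ (m * n + c) % k ^ μ₂ < a + k ^ μ₀)).card := by
        refine card_le_card fun n hn => ?_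
        rw [mem_filter] at hn ⊢
        refine ⟨hn.1, midDigit k μ₀ μ₂ (m * n + c) * k ^ μ₀, mem_image_of_mem _ hn.2, ?_⟩
        exact window_of_midDigit_eq hk hμ _
    _ ≤ (B.image (fun ℓ => ℓ * k ^ μ₀)).card * (N * Nat.gcd m (k ^ μ₂) / k ^ μ₂ + 1) *
          (k ^ μ₀ / Nat.gcd m (k ^ μ₂) + 2) := card_window_le hQ c N₀ N (k ^ μ₀) _
    _ ≤ B.card * ((N * Nat.gcd m (k ^ μ₂) / k ^ μ₂ + 1) * (k ^ μ₀ / Nat.gcd m (k ^ μ₂) + 2)) := by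
        rw [mul_assoc]
        exact Nat.mul_le_mul_right _ card_image_le

/-- The same in real numbers with the gcd's summed: for `M₀ ≥ 1`,
`#{(m,n) : r_{μ₀,μ₂}(mn + c) ∈ B} ≤ #B ((M₁ − M₀)(N k^{μ₀}/k^{μ₂} + k^{μ₀} + 2) + 4 τ(k^{μ₂}) M₁ N/k^{μ₂})`.
[cite: MauduitRivat2015, Lemma 9, (28); Mullner2017, Lemma 5.3] -/
theorem card_box_midDigit_mem_le {k : ℕ} (hk : 0 < k) {μ₀ μ₂ : ℕ} (hμ : μ₀ ≤ μ₂)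
    (B : Finset ℕ) (c : ℕ) {M₀ M₁ : ℕ} (hM₀ : 1 ≤ M₀) (N₀ N : ℕ) :
    ((((Ico M₀ M₁) ×ˢ (Ico N₀ (N₀ + N))).filter
        (fun p : ℕ × ℕ => midDigit k μ₀ μ₂ (p.1 * p.2 + c) ∈ B)).card : ℝ) ≤
      B.card * (((M₁ - M₀ : ℕ) : ℝ) * ((N : ℝ) * (k ^ μ₀ : ℕ) / (k ^ μ₂ : ℕ) + (k ^ μ₀ : ℕ) + 2) +
        4 * ((k ^ μ₂).divisors.card : ℝ) * M₁ * N / (k ^ μ₂ : ℕ)) := by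
  have hQ : 0 < k ^ μ₂ := by positivity
  have hQR : (0 : ℝ) < ((k ^ μ₂ : ℕ) : ℝ) := by exact_mod_cast hQ
  have hL : 0 < k ^ μ₀ := by positivity
  have h1 := card_box_midDigit_mem_le_sum hk hμ B c M₀ M₁ N₀ N
  have h1R : ((((Ico M₀ M₁) ×ˢ (Ico N₀ (N₀ + N))).filter
      (fun p : ℕ × ℕ => midDigit k μ₀ μ₂ (p.1 * p.2 + c) ∈ B)).card : ℝ) ≤
      B.card * ∑ m ∈ Ico M₀ M₁,
        (((N * Nat.gcd m (k ^ μ₂) / k ^ μ₂ + 1) * (k ^ μ₀ / Nat.gcd m (k ^ μ₂) + 2) : ℕ) : ℝ) := by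
    exact_mod_cast h1
  refine h1R.trans (mul_le_mul_of_nonneg_left ?_ (Nat.cast_nonneg _))
  -- termwise real bound
  have hterm : ∀ m ∈ Ico M₀ M₁,
      (((N * Nat.gcd m (k ^ μ₂) / k ^ μ₂ + 1) * (k ^ μ₀ / Nat.gcd m (k ^ μ₂) + 2) : ℕ) : ℝ) ≤
        ((N : ℝ) * (k ^ μ₀ : ℕ) / (k ^ μ₂ : ℕ) + (k ^ μ₀ : ℕ) + 2) +
          2 * N * (Nat.gcd m (k ^ μ₂) : ℝ) / (k ^ μ₂ : ℕ) := by
    intro m hm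
    set d := Nat.gcd m (k ^ μ₂) with hd
    have hd0 : 0 < d := Nat.gcd_pos_of_pos_right _ hQ
    have hdR : (0 : ℝ) < d := by exact_mod_cast hd0
    have hA : ((N * d / k ^ μ₂ : ℕ) : ℝ) ≤ (N : ℝ) * d / (k ^ μ₂ : ℕ) := by
      rw [le_div_iff₀ hQR]; exact_mod_cast Nat.div_mul_le_self (N * d) (k ^ μ₂)
    have hB : ((k ^ μ₀ / d : ℕ) : ℝ) ≤ ((k ^ μ₀ : ℕ) : ℝ) / d := by
      rw [le_div_iff₀ hdR]; exact_mod_cast Nat.div_mul_le_self (k ^ μ₀) d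
    have hB' : ((k ^ μ₀ / d : ℕ) : ℝ) ≤ ((k ^ μ₀ : ℕ) : ℝ) := by exact_mod_cast Nat.div_le_self _ _
    have hcast : ((((N * d / k ^ μ₂ + 1) * (k ^ μ₀ / d + 2)) : ℕ) : ℝ) =
        (((N * d / k ^ μ₂ : ℕ) : ℝ) + 1) * (((k ^ μ₀ / d : ℕ) : ℝ) + 2) := by
      push_cast; ring
    rw [hcast]
    calc (((N * d / k ^ μ₂ : ℕ) : ℝ) + 1) * (((k ^ μ₀ / d : ℕ) : ℝ) + 2)
        = ((N * d / k ^ μ₂ : ℕ) : ℝ) * ((k ^ μ₀ / d : ℕ) : ℝ) + 2 * ((N * d / k ^ μ₂ : ℕ) : ℝ) +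
            (((k ^ μ₀ / d : ℕ) : ℝ) + 2) := by ring
      _ ≤ ((N : ℝ) * d / (k ^ μ₂ : ℕ)) * (((k ^ μ₀ : ℕ) : ℝ) / d) + 2 * ((N : ℝ) * d / (k ^ μ₂ : ℕ)) +
            (((k ^ μ₀ : ℕ) : ℝ) + 2) := by
          gcongr
      _ = ((N : ℝ) * (k ^ μ₀ : ℕ) / (k ^ μ₂ : ℕ) + (k ^ μ₀ : ℕ) + 2) + 2 * N * (d : ℝ) / (k ^ μ₂ : ℕ) := by
          field_simp
          ring
  calc ∑ m ∈ Ico M₀ M₁,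
        (((N * Nat.gcd m (k ^ μ₂) / k ^ μ₂ + 1) * (k ^ μ₀ / Nat.gcd m (k ^ μ₂) + 2) : ℕ) : ℝ)
      ≤ ∑ m ∈ Ico M₀ M₁, (((N : ℝ) * (k ^ μ₀ : ℕ) / (k ^ μ₂ : ℕ) + (k ^ μ₀ : ℕ) + 2) +
          2 * N * (Nat.gcd m (k ^ μ₂) : ℝ) / (k ^ μ₂ : ℕ)) := sum_le_sum hterm
    _ = ((M₁ - M₀ : ℕ) : ℝ) * ((N : ℝ) * (k ^ μ₀ : ℕ) / (k ^ μ₂ : ℕ) + (k ^ μ₀ : ℕ) + 2) +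
          2 * N / (k ^ μ₂ : ℕ) * ∑ m ∈ Ico M₀ M₁, (Nat.gcd m (k ^ μ₂) : ℝ) := by
        rw [sum_add_distrib, sum_const, Nat.card_Ico, nsmul_eq_mul, mul_sum]
        congr 1
        exact sum_congr rfl fun m _ => by ring
    _ ≤ ((M₁ - M₀ : ℕ) : ℝ) * ((N : ℝ) * (k ^ μ₀ : ℕ) / (k ^ μ₂ : ℕ) + (k ^ μ₀ : ℕ) + 2) +
          2 * N / (k ^ μ₂ : ℕ) * (2 * ((k ^ μ₂).divisors.card : ℝ) * M₁) := by
        gcongr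
        exact_mod_cast sum_Ico_gcd_le (M₁ := M₁) hM₀ hQ
    _ = _ := by ring

/-! ## The conjugation identity for the second van der Corput step -/

/-- **The word identity** (Müllner, §5.4.2: "`tr(S̃'₂(r,s)) = tr(S'₂(r,s))`", in group form):
with `w(x,y) = f_{μ₂}(x) f_{μ₂}(y)⁻¹` and `φ = f_{μ₁}⁻¹ f_{μ₂}`, if `f_{μ₁}(x₁) = f_{μ₁}(x₄)` and
`f_{μ₁}(x₂) = f_{μ₁}(x₃)` then
`w(x₁,x₂) · w(x₄,x₃)⁻¹ = P (φx₁ (φx₂)⁻¹ φx₃ (φx₄)⁻¹) P⁻¹`, `P = f_{μ₁}(x₁)`.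
[cite: Mullner2017, §5.4.2 (p. 28)] -/
theorem quot_word_conj (k μ₁ μ₂ : ℕ) (f : ℕ → G) {x₁ x₂ x₃ x₄ : ℕ}
    (h14 : trunc k μ₁ f x₁ = trunc k μ₁ f x₄) (h23 : trunc k μ₁ f x₂ = trunc k μ₁ f x₃) :
    (trunc k μ₂ f x₁ * (trunc k μ₂ f x₂)⁻¹) * (trunc k μ₂ f x₄ * (trunc k μ₂ f x₃)⁻¹)⁻¹ =
      trunc k μ₁ f x₁ *
        (midQuot k μ₁ μ₂ f x₁ * (midQuot k μ₁ μ₂ f x₂)⁻¹ * midQuot k μ₁ μ₂ f x₃ *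
          (midQuot k μ₁ μ₂ f x₄)⁻¹) * (trunc k μ₁ f x₁)⁻¹ := by
  rw [← trunc_mul_midQuot k μ₁ μ₂ f x₁, ← trunc_mul_midQuot k μ₁ μ₂ f x₂,
    ← trunc_mul_midQuot k μ₁ μ₂ f x₃, ← trunc_mul_midQuot k μ₁ μ₂ f x₄, ← h14, h23]
  group

end Group

end Literature.NumberTheory.LFunctions.MauduitRivat
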